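import Summits.ABC.IUTFork.Thm311RealM
import Summits.ABC.IUTFork.Cor312ProvenanceDH
import HarnessLib

/-!
# [IUTchIII] Cor. 3.12 provenance over abc-iut-c312-5's REAL index skeleton (c312 crew, wave 2, W2-F glue)

Record-only glue (seat abc-iut-c312-8; board row W2-F), TAKES NO SIDE. abc-iut-c312-5's `Thm311RealM.lean` (W2-A)
instantiates c312-1's index skeleton FROM the initial Θ-data itself: `Thm311.Real.thetaIndexOfInitial D` with
`V := ↥D.V` (the section `V̲` of [IUTchI] Def. 3.1 (e)), `V^bad := V̲^bad`, `l⋇ := (l − 1)/2`. For any situation `S`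
over THAT index and any Cor. 3.12 setting `P` over `S` (c312-7), the index half of the provenance link
`Cor312Prov.IsSettingOf D P` holds BY CONSTRUCTION, and `𝕍(F)^bad` is finite for every `D` (`vFbad_finite`); so the
link reduces to its one quantitative field, [IUTchIV] p. 23's "`|log(q)|` of Cor. 3.12 `= (1/2l)·log(q)`":
`isSettingOf_ofInitial`. This is the "dependent-chain variant (T := idx D)" of the route target
(abc-iut-plan, INBOX 19:34:39Z) made a one-hypothesis statement. [claim: Mochizuki2012, status: disputed]
-/

noncomputable section

namespace Summit.ABC.IUTFork.Cor312Prov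

open Literature.IUT.HodgeTheaters NumberField

-- c312-5's `thetaIndexOfInitial` lives in universe `0` (`ThetaIndex.V : Type` forces `K : Type`), so this glue is
-- stated for `F K Fbar : Type`; the provenance decls it invokes are universe-polymorphic.
variable {F K Fbar : Type} [Field F] [NumberField F] [Field K] [NumberField K]
  [Algebra F K] [Field Fbar] [Algebra F Fbar] [Algebra K Fbar] {E : WeierstrassCurve F} [E.IsElliptic]
  {l : ℕ} {Pb : BadPlacePredicates K}

/-- Over c312-5's real index skeleton `Thm311.Real.thetaIndexOfInitial D` the provenance link `IsSettingOf D P`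
holds for EVERY setting `P` whose `q`-pilot log-volume is `−(1/2l)·log(q)` of `D` ([IUTchIV] kurims p. 23,
render `paper:url-56bcb0f95768` p0023 lines 61–67: "the quantity “|log(q)| ∈ ℝ_{>0}” defined in [IUTchIII],
Corollary 3.12, is equal to (1/2l)·log(q) ∈ ℝ [cf. the definition of “q_v” in [IUTchI], Example 3.2, (iv)]";
LOCATOR CORRECTED 2026-08-25 per ref-b B6-4/B7-4 — the earlier "l. 27–30" counted printed text lines, not render
lines): the index fields are `rfl`/`Iff.rfl` (`V = ↥D.V`, `V^bad = V̲^bad`, `l⋇ = (l−1)/2`) and `VFbad_finite` is the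
theorem `vFbad_finite D`. PROVED. [claim: Mochizuki2012, status: disputed] -/
theorem isSettingOf_ofInitial (D : InitialThetaData F K Fbar E l Pb)
    {S : Thm311.Situation (Thm311.Real.thetaIndexOfInitial D)} (P : Cor312.Setting S)
    (hq : P.negLogQ = -absLogq D) : IsSettingOf D P where
  lstar_eq := rfl
  places := ⟨Equiv.refl _, fun _ => Iff.rfl⟩
  VFbad_finite := vFbad_finite D
  negLogQ_eq := hq

/-- Hence, over the real index skeleton, the skeleton's `Thm110Data.Cor312` for `numbersOf D P I` is the VERBATIM
statement of Cor. 3.12 for `P` as soon as `−|log(q)| = −(1/2l)·log(q)` — the one-hypothesis form of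
`numbersOf_cor312_iff`. PROVED. [claim: Mochizuki2012, status: disputed] -/
theorem numbersOf_cor312_iff_ofInitial (D : InitialThetaData F K Fbar E l Pb)
    {S : Thm311.Situation (Thm311.Real.thetaIndexOfInitial D)} (P : Cor312.Setting S) (I : Thm110Inputs D)
    (hq : P.negLogQ = -absLogq D) : (numbersOf D P I).Cor312 ↔ P.Statement :=
  numbersOf_cor312_iff P I (isSettingOf_ofInitial D P hq)

end Summit.ABC.IUTFork.Cor312Prov

end
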